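import Summits.ABC.IUTFork.LDHGenuinePerImageUnconditionalDegree
import HarnessLib

/-!
# The fork at [IUTchIII] Corollary 3.12, L-DH level, READING (P): at EVERY point `λ ∈ U_X(F)` of EVERY number field the
# per-image Corollary AS TYPED holds at ALL BUT FINITELY MANY prime levels `l` — explicit threshold
# `l ≥ max(5, 8·[F_tpd:ℚ], exp((2/3)·[F_tpd:ℚ]·log q^{∤2}(λ)))` (abc-iut cell, branch C, row «C:PERIMAGE-P-ALL-LEVELS», file 5: any degree)

Record-only PROOF file (D-0012) of the abc-iut cell (branch-C certificate seat abc-iut-C-cert-2, gen 6; crux ThetaPartII =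
stmt-ABC-19678). TAKES NO SIDE on [IUTchIII] Cor. 3.12 (S. Mochizuki, *Inter-universal Teichmüller theory III*, Cor. 3.12
p. 173–174) or on any author. Files 1–4 of the row treated rational data (`LDHGenuinePerImageAllLevels{,B,C,Rat}`). HERE the point
has ANY degree: abc-iut-C-cert-1's any-degree unconditional sufficiency `cor312PerImageOf_of_le_degree_all`
(`LDHGenuinePerImageUnconditionalDegree`, composing abc-iut-c312-d1's ramified datum-level sufficiency p467927 with abc-iut-s2-p4's
`μ_l ⊆ K` tower form) asks, at a prime `l ≥ 5` with `d_mod ≤ (l+5)/4`, for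
`κ_l·log q^{∤2l} ≤ ((l+5)/4 − d_mod)·(log-diff + (1 − 1/l)·log 𝔣^{∤2l} + (1 − [F_tpd:ℚ]/(l−1))·[F_tpd:ℚ]⁻¹·log l) + ((l+5)/4)·log π`.
Its left side is at most `((l+1)/24)·log q^{∤2}(λ)` (`logQAvoid_anti`: avoiding more places only lowers the `q`-term), a LINEAR function
of `l` with a coefficient that does not depend on `l`; its right side contains `((l+5)/4 − d_mod)·(1 − [F_tpd:ℚ]/(l−1))·[F_tpd:ℚ]⁻¹·log l`,
which grows like `l·log l`. Hence:

* **`cor312PerImageOf_of_exp_le`** — for `P ∈ U_X(F)`, a prime `l ≥ 5` with `8·[F_tpd:ℚ] ≤ l` and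
  `exp((2/3)·[F_tpd:ℚ]·log q^{∤2}(λ)) ≤ l`: `T.Cor312PerImageOf` for EVERY genuine Θ-volume datum `T` of `(λ, l)`;
* **`cor312PerImageOf_eventually`** — for `P ∈ U_X(F)`: `∃ L, ∀ prime l ≥ L, ∀ T, T.Cor312PerImageOf`.

READING (neutral; branch-C books): the reading-(P) number-level binders (`hNumPOffBad` of
`Conditional.abc_of_slotLicence_orNumP_K_szpiroBad_read`, p462946; its M twin) quantify over ALL admissible `(P, l)` and conclude
`T.Cor312PerImageOf`; at EACH point `P` (any number field) that conclusion is TRUE at every prime level beyond an explicit `L(P)`, so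
the binders carry content only on a finite set of levels per point — a window that print's own choice of `l` ([IUTchIV] Cor. 2.2: `l`
of the order of the height, far below `exp((2/3)·d·log q)`) lies inside; nothing here bears on that window, on print's (Ind2) (the
(P) reading's (Ind2) is the cell's full lattice-automorphism typing, Dupuy–Hilado §4.9) or on the printed inequality; no certificate's
hypothesis count moves; nothing asserts that genuine data exist at any `(λ, l)`, Cor. 3.12 in general, or abc; proved-as-typed ≠ in
print; typed ≠ proved. [cite: Mochizuki2012, IUTchIII Cor. 3.12 p. 173–174, proof Step (x) p. 181; IUTchIV Thm. 1.10 p. 22–24, Step (v)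
p. 27–29, Cor. 2.2 (ii) p. 44–46] [cite: DupuyHilado2025, §4.9, §4.12] [claim: Mochizuki2012, status: disputed] for every IUT quotation.
PROOF-ONLY: no definitions, no new `Prop`.
-/

noncomputable section

namespace Literature.IUT.LogVolume.Cor22

open NumberField IsDedekindDomain Ideal Module Literature.NumberTheory.DiophantineGeometry
open Literature.NumberTheory.DiophantineGeometry.GenEll Summit.ABC.IUTFork Literature.IUT.HodgeTheaters

/-- **READING (P) AT ANY POINT, EVERY PRIME LEVEL ABOVE AN EXPLICIT THRESHOLD.** For `P = (F, λ)` with `λ ∈ U_X(F)`, a prime `l ≥ 5`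
with `8·[F_tpd:ℚ] ≤ l` and `exp((2/3)·[F_tpd:ℚ]·log q^{∤2}(λ)) ≤ l`: `T.Cor312PerImageOf` for every genuine Θ-volume datum `T` of
`(λ, l)` — by `cor312PerImageOf_of_le_degree_all` with `log q^{∤2l} ≤ log q^{∤2}` (`logQAvoid_anti`), `κ_l ≤ (l+1)/24`,
`(l+5)/4 − d_mod ≥ (l+1)/8` (`d_mod ≤ [F_tpd:ℚ] ≤ l/8`), `1 − [F_tpd:ℚ]/(l−1) ≥ ½`, `[F_tpd:ℚ]⁻¹·log l ≥ (2/3)·log q^{∤2}`, and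
`log-diff, log 𝔣, log π ≥ 0`. [cite: Mochizuki2012, IUTchIII Cor. 3.12 p. 173–174; IUTchIV Thm. 1.10 Step (v) p. 27–29]
[claim: Mochizuki2012, status: disputed] -/
theorem cor312PerImageOf_of_exp_le {P : NFPoint} {l : ℕ} (hU : P.InU) (hl : l.Prime) (h5 : 5 ≤ l)
    (hdeg : 8 * P.degree ≤ l) (hB : Real.exp (2 / 3 * (P.degree : ℝ) * logQAvoid P {2}) ≤ l) :
    ∀ T : ThetaVolumeDatumAt P l, T.Cor312PerImageOf := by
  have hdegpos : 0 < P.degree := P.degree_pos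
  have hdeg1 : (1 : ℝ) ≤ P.degree := by exact_mod_cast hdegpos
  have hdegR : 8 * (P.degree : ℝ) ≤ l := by exact_mod_cast hdeg
  have hl5 : (5 : ℝ) ≤ l := by exact_mod_cast h5
  have hlpos : (0 : ℝ) < l := by linarith
  have hdmod : (dmod P : ℝ) ≤ P.degree := by exact_mod_cast dmod_le_degree P
  -- the `q`-side bound
  set B := logQAvoid P {2} with hBdef
  have hB0 : 0 ≤ B := logQAvoid_nonneg P {2}
  have hLQ : logQAvoid P {2, l} ≤ B := logQAvoid_anti P (Finset.subset_insert l {2} |>.trans (by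
    intro x hx; simpa [Finset.mem_insert, Finset.mem_singleton, or_comm] using hx))
  have hLQ0 : 0 ≤ logQAvoid P {2, l} := logQAvoid_nonneg P _
  have hlogl : 2 / 3 * (P.degree : ℝ) * B ≤ Real.log l := by
    have h := Real.log_le_log (Real.exp_pos _) hB
    rwa [Real.log_exp] at h
  -- the conductor-side nonnegativity
  have hLD : 0 ≤ P.logDiff := P.logDiff_nonneg
  have hLC : 0 ≤ logCondAvoid P {2, l} := logCondAvoid_nonneg P _
  have hpi : 0 < Real.log Real.pi := Real.log_pos (by linarith [Real.pi_gt_three])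
  refine cor312PerImageOf_of_le_degree_all hU hl h5 (by linarith) ?_
  -- abbreviations
  set X := ((l : ℝ) + 5) / 4 - (dmod P : ℝ) with hX
  set Y := 1 - (P.degree : ℝ) / ((l : ℝ) - 1) with hY
  set Z := (P.degree : ℝ)⁻¹ * Real.log l with hZ
  have hXa : ((l : ℝ) + 1) / 8 ≤ X := by rw [hX]; linarith
  have hX0 : 0 ≤ X := le_trans (by positivity) hXa
  have hY2 : (1 : ℝ) / 2 ≤ Y := by
    rw [hY]
    have hl1 : (0 : ℝ) < (l : ℝ) - 1 := by linarith
    have : (P.degree : ℝ) / ((l : ℝ) - 1) ≤ 1 / 2 := by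
      rw [div_le_iff₀ hl1]; linarith
    linarith
  have hY0 : 0 ≤ Y := le_trans (by norm_num) hY2
  have hZB : 2 / 3 * B ≤ Z := by
    rw [hZ]
    have hdinv : 0 < (P.degree : ℝ)⁻¹ := inv_pos.2 (by linarith)
    have h1 : (P.degree : ℝ)⁻¹ * (2 / 3 * (P.degree : ℝ) * B) ≤ (P.degree : ℝ)⁻¹ * Real.log l :=
      mul_le_mul_of_nonneg_left hlogl hdinv.le
    have h2 : (P.degree : ℝ)⁻¹ * (2 / 3 * (P.degree : ℝ) * B) = 2 / 3 * B := by
      field_simp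
    linarith
  have hZ0 : 0 ≤ Z := le_trans (by positivity) hZB
  -- `X·Y·Z ≥ (l+1)/8 · ½ · (2B/3) = (l+1)·B/24`
  have hXY : ((l : ℝ) + 1) / 8 * (1 / 2) ≤ X * Y := mul_le_mul hXa hY2 (by norm_num) hX0
  have hXYZ : ((l : ℝ) + 1) / 8 * (1 / 2) * (2 / 3 * B) ≤ X * Y * Z :=
    mul_le_mul hXY hZB (by positivity) (mul_nonneg hX0 hY0)
  -- the `q`-side: `κ_l·log q^{∤2l} ≤ (l+1)/24 · B`
  have hκ : (((l : ℝ) + 1) / 24 - 1 / (2 * l)) * logQAvoid P {2, l} ≤ ((l : ℝ) + 1) / 24 * B := by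
    have ha : 0 ≤ 1 / (2 * (l : ℝ)) * logQAvoid P {2, l} := mul_nonneg (by positivity) hLQ0
    have hb : ((l : ℝ) + 1) / 24 * logQAvoid P {2, l} ≤ ((l : ℝ) + 1) / 24 * B :=
      mul_le_mul_of_nonneg_left hLQ (by positivity)
    nlinarith
  -- the conductor side: drop the nonnegative `log-diff`, `log 𝔣` terms
  have hmain : X * (Y * Z) ≤ X * (P.logDiff + (1 - 1 / (l : ℝ)) * logCondAvoid P {2, l} + Y * Z) := by
    refine mul_le_mul_of_nonneg_left ?_ hX0
    have h1l : 0 ≤ 1 - 1 / (l : ℝ) := by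
      have : 1 / (l : ℝ) ≤ 1 / 5 := one_div_le_one_div_of_le (by norm_num) hl5
      linarith
    nlinarith [mul_nonneg h1l hLC]
  have hpi' : 0 ≤ ((l : ℝ) + 5) / 4 * Real.log Real.pi := by positivity
  calc (((l : ℝ) + 1) / 24 - 1 / (2 * l)) * logQAvoid P {2, l}
      ≤ ((l : ℝ) + 1) / 24 * B := hκ
    _ = ((l : ℝ) + 1) / 8 * (1 / 2) * (2 / 3 * B) := by ring
    _ ≤ X * Y * Z := hXYZ
    _ = X * (Y * Z) := by ring
    _ ≤ X * (P.logDiff + (1 - 1 / (l : ℝ)) * logCondAvoid P {2, l} + Y * Z) := hmain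
    _ ≤ X * (P.logDiff + (1 - 1 / (l : ℝ)) * logCondAvoid P {2, l} + Y * Z) + ((l : ℝ) + 5) / 4 * Real.log Real.pi := by
        linarith
    _ = _ := by rw [hX, hY, hZ]

/-- **COFINITENESS IN `l` AT EVERY POINT OF `U_X` OVER EVERY NUMBER FIELD**: for `P = (F, λ)`, `λ ∈ U_X(F)`, there is an
(explicit) `L` such that for EVERY prime `l ≥ L` and EVERY genuine Θ-volume datum `T` of `(λ, l)`, `T.Cor312PerImageOf` — the
reading-(P) per-image Corollary AS TYPED is true at all but finitely many levels of every point. [cite: Mochizuki2012, IUTchIII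
Cor. 3.12 p. 173–174; IUTchIV Thm. 1.10 Step (v) p. 27–29] [claim: Mochizuki2012, status: disputed] -/
theorem cor312PerImageOf_eventually {P : NFPoint} (hU : P.InU) :
    ∃ L : ℕ, ∀ l : ℕ, l.Prime → L ≤ l → ∀ T : ThetaVolumeDatumAt P l, T.Cor312PerImageOf := by
  refine ⟨max (max 5 (8 * P.degree)) ⌈Real.exp (2 / 3 * (P.degree : ℝ) * logQAvoid P {2})⌉₊, fun l hl hL T => ?_⟩
  have h5 : 5 ≤ l := le_trans (le_trans (le_max_left _ _) (le_max_left _ _)) hL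
  have hdeg : 8 * P.degree ≤ l := le_trans (le_trans (le_max_right _ _) (le_max_left _ _)) hL
  have hceil : ⌈Real.exp (2 / 3 * (P.degree : ℝ) * logQAvoid P {2})⌉₊ ≤ l := le_trans (le_max_right _ _) hL
  have hB : Real.exp (2 / 3 * (P.degree : ℝ) * logQAvoid P {2}) ≤ l :=
    le_trans (Nat.le_ceil _) (by exact_mod_cast hceil)
  exact cor312PerImageOf_of_exp_le hU hl h5 hdeg hB T

end Literature.IUT.LogVolume.Cor22

end
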